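import Summits.Ventures.PercRepro.ProfilePointedCircuitClassesStarSharpLoopB
import Summits.Ventures.PercRepro.ProfilePointedCircuitClassesStarSharpD0Y

/-!
# PercRepro — THE ALL-ON CORE OF `StarNineSharp` (THE LOOP REGIME OF D0), PART C: AT MOST TWO DEFECTS
(p5, gen 55; `proofs/P5-GM1.md` §82 ADD 2)

In the loop regime (`ρ{b, b′} = 1`: `{b, b′}` is a circuit as well as a cocircuit of `N`, every `S ⊆ E₇` is ON) the
`b′`-avoiding inequality reads `|G_e| ≤ |G_f| + |C|`; the demands with a swap (`d0c0`) inject into the ON sets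
`{b, f} + π` (`d0_injR0`), so it reduces to `|bad| ≤ |C|` for the e-defects `bad = G_e ∖ G_f`.
`inCount_thru_le_of_loop_of_le_two_bad`: with at most two defects this holds — one defect has a C-endpoint
(`c_point_exists`), two defects have two C-endpoints or share their unique one, in which case the two remaining points
of `X` are C-points (`cpoints_of_shared_endpoint`).  Coverage: 1,313 of the 1,490 loop configurations of D0
(those with ≤ 2 defects); three defects need the three-endpoint fact (§82 ADD 2).
-/

open scoped Matroid

namespace PercRepro.Cogirth

open Finset ThmH Skew Shadow Profile

open Classical

variable {α : Type} [DecidableEq α] {N : Matroid α} [N.Finite]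

section StarSharpLoopC

variable {b b' : α}

/-- In the loop regime every `S ⊆ E₇` is ON: `ρ(S ∪ {b, b′}) = ρ(S) + 1` (`b ∈ cl{b′}`). -/
theorem rk_insert_bb'_eq_add_one_of_loop (h : SeriesPair N b b') (hbb : rk N {b, b'} = 1) {S : Finset α}
    (hS : S ⊆ ((gr N).erase b).erase b') : rk N (insert b (insert b' S)) = rk N S + 1 := by
  have h1 := rk_insert_right_eq_add_one_of_seriesPair h hS
  have hb' : rk N ({b'} : Finset α) = 1 := rk_singleton_eq_one_of_seriesPair h.symm
  have h2 : rk N (insert b ({b'} : Finset α)) = rk N ({b'} : Finset α) := by rw [hbb, hb']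
  have h3 := rk_insert_eq_of_rk_insert_eq_subset' (N := N) (S := ({b'} : Finset α)) (S' := insert b' S) (w := b)
    (singleton_subset_iff.2 (mem_insert_self _ _)) h2
  rw [h3, h1]

/-- The ON target `{e, f, x} + b` of a C-point `x` (loop regime). -/
theorem cpoint_target_mem_of_loop (h : SeriesPair N b b') (hn : (gr N).card = 9) (hbb : rk N {b, b'} = 1)
    {e f : α} (he : e ∈ gr N) (hf : f ∈ gr N) (hef : e ≠ f) (heb : e ≠ b) (heb' : e ≠ b') (hfb : f ≠ b) (hfb' : f ≠ b')
    {x : α} (hx : x ∈ ((((gr N).erase b).erase b').erase f).erase e) (hefx : rk N {e, f, x} = 3)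
    (hx4 : rk N ((((((gr N).erase b).erase b').erase f).erase e).erase x) = 4) :
    insert b {e, f, x} ∈ (biIndepSets N 4).filter (fun W => (f ∈ W ∧ b' ∉ W) ∧
      (e ∈ W ∧ b ∈ W ∧ ¬ (gr N \ W).erase b' ∈ biIndepSets N 4)) := by
  have hbb' : b ≠ b' := h.2.2.1
  have hXE : ((((gr N).erase b).erase b').erase f).erase e ⊆ ((gr N).erase b).erase b' :=
    (erase_subset _ _).trans (erase_subset _ _)
  have hxE := hXE hx
  have hxe : x ≠ e := (mem_erase.1 hx).1
  have hxf : x ≠ f := (mem_erase.1 (mem_erase.1 hx).2).1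
  have hS : ({e, f, x} : Finset α) ⊆ ((gr N).erase b).erase b' := by
    intro w hw; simp only [mem_insert, mem_singleton] at hw
    rcases hw with rfl | rfl | rfl
    · exact mem_erase.2 ⟨heb', mem_erase.2 ⟨heb, he⟩⟩
    · exact mem_erase.2 ⟨hfb', mem_erase.2 ⟨hfb, hf⟩⟩
    · exact hxE
  have hS3' : ({e, f, x} : Finset α).card = 3 := by
    rw [card_insert_of_notMem, card_pair hxf.symm]
    simp only [mem_insert, mem_singleton, not_or]; exact ⟨hef, hxe.symm⟩
  have hon : rk N (insert b (insert b' {e, f, x})) = 4 := by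
    rw [rk_insert_bb'_eq_add_one_of_loop h hbb hS, hefx]
  simp only [mem_filter]
  refine ⟨?_, ⟨mem_insert_of_mem (mem_insert_of_mem (mem_insert_self _ _)), ?_⟩,
    mem_insert_of_mem (mem_insert_self _ _), mem_insert_self _ _, ?_⟩
  · rw [insert_b_mem_biIndepSets_iff h hn hS hS3', E7_sdiff_efx_eq]
    exact ⟨hefx, hx4⟩
  · intro h'
    simp only [mem_insert, mem_singleton] at h'
    rcases h' with h2 | h2 | h2 | h2
    · exact hbb' h2.symm
    · exact heb' h2.symm
    · exact hfb' h2.symm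
    · exact (mem_erase.1 hxE).1 h2.symm
  · rw [off_image_efx_iff h hn he hf hef heb heb' hfb hfb' hx]
    rintro ⟨-, h5⟩
    omega

/-- Two C-point targets with distinct points are distinct. -/
theorem cpoint_target_injective {e f x y : α} (hx : x ∈ ((((gr N).erase b).erase b').erase f).erase e)
    (heq : insert b ({e, f, x} : Finset α) = insert b {e, f, y}) : x = y := by
  have h1 : x ∈ insert b ({e, f, y} : Finset α) := by
    rw [← heq]; exact mem_insert_of_mem (mem_insert_of_mem (mem_insert_of_mem (mem_singleton_self _)))
  simp only [mem_insert, mem_singleton] at h1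
  rcases h1 with h1 | h1 | h1 | h1
  · exact absurd h1 (mem_erase.1 (mem_erase.1 (mem_erase.1 (mem_erase.1 hx).2).2).2).1
  · exact absurd h1 (mem_erase.1 hx).1
  · exact absurd h1 (mem_erase.1 (mem_erase.1 hx).2).1
  · exact h1

/-- Two distinct C-points give two ON targets. -/
theorem two_le_card_targets_of_loop (h : SeriesPair N b b') (hn : (gr N).card = 9) (hbb : rk N {b, b'} = 1)
    {e f : α} (he : e ∈ gr N) (hf : f ∈ gr N) (hef : e ≠ f) (heb : e ≠ b) (heb' : e ≠ b') (hfb : f ≠ b) (hfb' : f ≠ b')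
    {x y : α} (hxy : x ≠ y) (hx : x ∈ ((((gr N).erase b).erase b').erase f).erase e)
    (hy : y ∈ ((((gr N).erase b).erase b').erase f).erase e) (hefx : rk N {e, f, x} = 3)
    (hx4 : rk N ((((((gr N).erase b).erase b').erase f).erase e).erase x) = 4) (hefy : rk N {e, f, y} = 3)
    (hy4 : rk N ((((((gr N).erase b).erase b').erase f).erase e).erase y) = 4) :
    2 ≤ ((biIndepSets N 4).filter (fun W => (f ∈ W ∧ b' ∉ W) ∧
      (e ∈ W ∧ b ∈ W ∧ ¬ (gr N \ W).erase b' ∈ biIndepSets N 4))).card := by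
  have h1 := cpoint_target_mem_of_loop h hn hbb he hf hef heb heb' hfb hfb' hx hefx hx4
  have h2 := cpoint_target_mem_of_loop h hn hbb he hf hef heb heb' hfb hfb' hy hefy hy4
  have hsub : ({insert b {e, f, x}, insert b {e, f, y}} : Finset (Finset α)) ⊆
      (biIndepSets N 4).filter (fun W => (f ∈ W ∧ b' ∉ W) ∧
        (e ∈ W ∧ b ∈ W ∧ ¬ (gr N \ W).erase b' ∈ biIndepSets N 4)) := by
    intro W hW
    simp only [mem_insert, mem_singleton] at hW
    rcases hW with rfl | rfl
    · exact h1
    · exact h2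
  have := card_le_card hsub
  rw [card_pair (fun h' => hxy (cpoint_target_injective hx h'))] at this
  exact this

/-- **THE LOOP REGIME FROM A BOUND ON THE DEFECTS**: `ρ{b, b′} = 1` (every set ON); if the demands without a swap are
at most the ON targets `{e, f, x} + b`, the `b′`-avoiding inequality holds (the swaps inject by `d0_injR0`, the OFF
demands — none here, but the argument is uniform — by `card_off_demands_le`). -/
theorem inCount_thru_le_of_loop_of_bad_bound (hn : (gr N).card = 9) (h : SeriesPair N b b')
    {e f : α} (he : e ∈ gr N) (hf : f ∈ gr N) (hef : e ≠ f) (heb : e ≠ b) (heb' : e ≠ b') (hfb : f ≠ b) (hfb' : f ≠ b')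
    (hbad : ((d0DON N b' e f).filter (fun W => ¬ d0c0 N b b' e f W)).card ≤
      ((biIndepSets N 4).filter (fun W => (f ∈ W ∧ b' ∉ W) ∧
        (e ∈ W ∧ b ∈ W ∧ ¬ (gr N \ W).erase b' ∈ biIndepSets N 4))).card) :
    inCount N 4 e + thruCount N 4 {b', f} + thruCount N 4 {b', e, f} ≤
      inCount N 4 f + thruCount N 4 {e, f} + thruCount N 4 {b', e} := by
  rw [inCount_thru_split']
  have hsplit := card_filter_add_card_filter_not (s := (biIndepSets N 4).filter (fun W => (e ∈ W ∧ f ∉ W) ∧ b' ∉ W))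
    (fun W => (gr N \ W).erase b' ∈ biIndepSets N 4)
  simp only [filter_filter] at hsplit
  have htar : ((biIndepSets N 4).filter (fun W => (f ∈ W ∧ b' ∉ W) ∧ (e ∉ W ∧ (gr N \ W).erase b' ∈ biIndepSets N 4))).card +
      ((biIndepSets N 4).filter (fun W => (f ∈ W ∧ b' ∉ W) ∧ (e ∉ W ∧ b ∈ W ∧ ¬ (gr N \ W).erase b' ∈ biIndepSets N 4))).card +
      ((biIndepSets N 4).filter (fun W => (f ∈ W ∧ b' ∉ W) ∧ (e ∈ W ∧ b ∈ W ∧ ¬ (gr N \ W).erase b' ∈ biIndepSets N 4))).card ≤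
      ((biIndepSets N 4).filter (fun W => f ∈ W ∧ b' ∉ W)).card := by
    rw [← card_union_of_disjoint, ← card_union_of_disjoint]
    · apply card_le_card
      intro W hW
      simp only [mem_union, mem_filter] at hW ⊢
      rcases hW with (hW | hW) | hW <;> exact ⟨hW.1, hW.2.1⟩
    · rw [disjoint_union_left]
      refine ⟨?_, ?_⟩ <;> rw [disjoint_filter]
      · rintro W _ ⟨-, heW, -⟩ ⟨-, heW', -, -⟩; exact heW heW'
      · rintro W _ ⟨-, heW, -, -⟩ ⟨-, heW', -, -⟩; exact heW heW'
    · rw [disjoint_filter]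
      rintro W _ ⟨-, -, hc⟩ ⟨-, -, -, hc'⟩; exact hc' hc
  have hinj1 := card_off_demands_le (N := N) (b' := b') (e := e) hf hfb'
  have hs1 := card_filter_add_card_filter_not (s := d0DON N b' e f) (fun W => d0c0 N b b' e f W)
  have hinjR0 := d0_injR0 h hn he hf hef heb heb' hfb hfb'
  have hDON : (d0DON N b' e f).card = ((biIndepSets N 4).filter (fun W => ((e ∈ W ∧ f ∉ W) ∧ b' ∉ W) ∧
      ¬ (gr N \ W).erase b' ∈ biIndepSets N 4)).card := rfl
  rw [← hDON] at hsplit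
  omega

/-- The data of a defect (loop regime): its pair, the facts, and a C-endpoint. -/
theorem defect_data_of_loop (hn : (gr N).card = 9) (h : SeriesPair N b b')
    {e f : α} (he : e ∈ gr N) (hf : f ∈ gr N) (hef : e ≠ f) (heb : e ≠ b) (heb' : e ≠ b') (hfb : f ≠ b) (hfb' : f ≠ b')
    (he1 : ∀ y ∈ ((((gr N).erase b).erase b').erase f).erase e, rk N {e, y} = 2)
    (hf1 : ∀ y ∈ ((((gr N).erase b).erase b').erase f).erase e, rk N {f, y} = 2)
    (hX : rk N (((((gr N).erase b).erase b').erase f).erase e) = 4) (hef2 : rk N {e, f} = 2)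
    (hbb : rk N {b, b'} = 1) :
    ∀ W ∈ (d0DON N b' e f).filter (fun W => ¬ d0c0 N b b' e f W),
      (W.erase b).erase e ⊆ ((((gr N).erase b).erase b').erase f).erase e ∧ ((W.erase b).erase e).card = 2 ∧
      insert b (insert e ((W.erase b).erase e)) = W ∧ rk N (insert e ((W.erase b).erase e)) = 3 ∧
      rk N (insert f (((((gr N).erase b).erase b').erase f).erase e \ (W.erase b).erase e)) = 4 ∧
      ¬ (rk N (insert f ((W.erase b).erase e)) = 3 ∧
        rk N (insert e (((((gr N).erase b).erase b').erase f).erase e \ (W.erase b).erase e)) = 4) ∧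
      ∃ x ∈ (W.erase b).erase e, rk N {e, f, x} = 3 ∧ rk N ((((((gr N).erase b).erase b').erase f).erase e).erase x) = 4 := by
  have hXE : ((((gr N).erase b).erase b').erase f).erase e ⊆ ((gr N).erase b).erase b' :=
    (erase_subset _ _).trans (erase_subset _ _)
  have hfE : f ∈ ((gr N).erase b).erase b' := mem_erase.2 ⟨hfb', mem_erase.2 ⟨hfb, hf⟩⟩
  have hdata := d0_demand_data h hn hf hef heb hfb hfb' (e := e)
  intro W hW
  simp only [d0DON, mem_filter] at hW
  obtain ⟨⟨hWs, hPD, hcW⟩, hnc₀⟩ := hW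
  obtain ⟨-, hπX, hπ2, hYeq, hWeq', hYr, hYc, -⟩ := hdata W hWs hPD hcW
  have hres : ¬ (rk N (insert f ((W.erase b).erase e)) = 3 ∧
      rk N (insert e (((((gr N).erase b).erase b').erase f).erase e \ (W.erase b).erase e)) = 4) := by
    rintro ⟨h1, h2⟩
    apply hnc₀
    refine ⟨h1, h2, ?_⟩
    rw [rk_insert_bb'_eq_add_one_of_loop h hbb (insert_subset hfE (hπX.trans hXE)), h1]
  refine ⟨hπX, hπ2, by rw [hYeq, hWeq'], hYr, hYc, hres, ?_⟩
  exact c_point_exists h hn he hf hef heb heb' hfb hfb' hef2 he1 hf1 hX hπX hπ2 hYr hYc hres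

/-- **AT MOST TWO DEFECTS ARE AT MOST THE C-POINT TARGETS** (loop regime). -/
theorem card_bad_le_targets_of_card_le_two (hn : (gr N).card = 9) (h : SeriesPair N b b')
    {e f : α} (he : e ∈ gr N) (hf : f ∈ gr N) (hef : e ≠ f) (heb : e ≠ b) (heb' : e ≠ b') (hfb : f ≠ b) (hfb' : f ≠ b')
    (he1 : ∀ y ∈ ((((gr N).erase b).erase b').erase f).erase e, rk N {e, y} = 2)
    (hf1 : ∀ y ∈ ((((gr N).erase b).erase b').erase f).erase e, rk N {f, y} = 2)
    (hfc : ∀ y ∈ ((((gr N).erase b).erase b').erase f).erase e, rk N (((((gr N).erase b).erase b').erase f).erase y) = 4)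
    (hX : rk N (((((gr N).erase b).erase b').erase f).erase e) = 4) (hef2 : rk N {e, f} = 2)
    (hbb : rk N {b, b'} = 1)
    (h2 : ((d0DON N b' e f).filter (fun W => ¬ d0c0 N b b' e f W)).card ≤ 2) :
    ((d0DON N b' e f).filter (fun W => ¬ d0c0 N b b' e f W)).card ≤
      ((biIndepSets N 4).filter (fun W => (f ∈ W ∧ b' ∉ W) ∧
        (e ∈ W ∧ b ∈ W ∧ ¬ (gr N \ W).erase b' ∈ biIndepSets N 4))).card := by
  have hb : b ∈ gr N := h.1
  have hb' : b' ∈ gr N := h.2.1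
  have hbb' : b ≠ b' := h.2.2.1
  have heE : e ∈ ((gr N).erase b).erase b' := mem_erase.2 ⟨heb', mem_erase.2 ⟨heb, he⟩⟩
  have hfE : f ∈ ((gr N).erase b).erase b' := mem_erase.2 ⟨hfb', mem_erase.2 ⟨hfb, hf⟩⟩
  have hX5 : (((((gr N).erase b).erase b').erase f).erase e).card = 5 := by
    rw [card_erase_of_mem (mem_erase.2 ⟨hef, heE⟩), card_erase_of_mem hfE,
      card_erase_of_mem (mem_erase.2 ⟨hbb'.symm, hb'⟩), card_erase_of_mem hb, hn]
  have hbadC := defect_data_of_loop hn h he hf hef heb heb' hfb hfb' he1 hf1 hX hef2 hbb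
  rcases Nat.lt_or_ge ((d0DON N b' e f).filter (fun W => ¬ d0c0 N b b' e f W)).card 1 with h0 | h1
  · omega
  · by_cases hcard : ((d0DON N b' e f).filter (fun W => ¬ d0c0 N b b' e f W)).card = 1
    · obtain ⟨W, hW⟩ := card_pos.1 h1
      obtain ⟨hπX, -, -, -, -, -, x, hxπ, hefx, hx4⟩ := hbadC W hW
      have := card_pos.2 ⟨_, cpoint_target_mem_of_loop h hn hbb he hf hef heb heb' hfb hfb' (hπX hxπ) hefx hx4⟩
      omega
    · have hcard2 : ((d0DON N b' e f).filter (fun W => ¬ d0c0 N b b' e f W)).card = 2 := by omega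
      obtain ⟨W₁, W₂, hW12, hset⟩ := card_eq_two.1 hcard2
      have hW₁ : W₁ ∈ (d0DON N b' e f).filter (fun W => ¬ d0c0 N b b' e f W) := by
        rw [hset]; exact mem_insert_self _ _
      have hW₂ : W₂ ∈ (d0DON N b' e f).filter (fun W => ¬ d0c0 N b b' e f W) := by
        rw [hset]; exact mem_insert_of_mem (mem_singleton_self _)
      obtain ⟨hπX₁, hπ2₁, hWeq₁, hY₁, hYc₁, hres₁, x₁, hx₁π, hefx₁, hx₁4⟩ := hbadC W₁ hW₁
      obtain ⟨hπX₂, hπ2₂, hWeq₂, hY₂, hYc₂, hres₂, x₂, hx₂π, hefx₂, hx₂4⟩ := hbadC W₂ hW₂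
      by_cases hx12 : x₁ = x₂
      · -- the shared C-endpoint `c`
        subst hx12
        set c := x₁ with hcdef
        have hπne : (W₁.erase b).erase e ≠ (W₂.erase b).erase e := by
          intro h'; apply hW12; rw [← hWeq₁, ← hWeq₂, h']
        -- `π₁ = {c, u}`, `π₂ = {c, v}`
        obtain ⟨u, hu_mem, hπ₁eq⟩ : ∃ u ∈ (W₁.erase b).erase e, u ≠ c ∧ (W₁.erase b).erase e = {c, u} := by
          obtain ⟨a, a', haa', heq⟩ := card_eq_two.1 hπ2₁
          rw [heq] at hx₁π
          simp only [mem_insert, mem_singleton] at hx₁π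
          rcases hx₁π with rfl | rfl
          · exact ⟨a', by rw [heq]; exact mem_insert_of_mem (mem_singleton_self _), haa'.symm, heq⟩
          · exact ⟨a, by rw [heq]; exact mem_insert_self _ _, haa', by rw [heq, pair_comm']⟩
        obtain ⟨huc, hπ₁eq⟩ := hπ₁eq
        obtain ⟨v, hv_mem, hπ₂eq⟩ : ∃ v ∈ (W₂.erase b).erase e, v ≠ c ∧ (W₂.erase b).erase e = {c, v} := by
          obtain ⟨a, a', haa', heq⟩ := card_eq_two.1 hπ2₂
          rw [heq] at hx₂π
          simp only [mem_insert, mem_singleton] at hx₂π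
          rcases hx₂π with rfl | rfl
          · exact ⟨a', by rw [heq]; exact mem_insert_of_mem (mem_singleton_self _), haa'.symm, heq⟩
          · exact ⟨a, by rw [heq]; exact mem_insert_self _ _, haa', by rw [heq, pair_comm']⟩
        obtain ⟨hvc, hπ₂eq⟩ := hπ₂eq
        have huv : u ≠ v := by
          intro h'; apply hπne; rw [hπ₁eq, hπ₂eq, h']
        have hcX := hπX₁ hx₁π
        have huX := hπX₁ hu_mem
        have hvX := hπX₂ hv_mem
        by_cases hu : rk N {e, f, u} = 3 ∧ rk N ((((((gr N).erase b).erase b').erase f).erase e).erase u) = 4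
        · have h' := two_le_card_targets_of_loop h hn hbb he hf hef heb heb' hfb hfb' huc huX hcX hu.1 hu.2 hefx₁ hx₁4
          omega
        by_cases hv : rk N {e, f, v} = 3 ∧ rk N ((((((gr N).erase b).erase b').erase f).erase e).erase v) = 4
        · have h' := two_le_card_targets_of_loop h hn hbb he hf hef heb heb' hfb hfb' hvc hvX hcX hv.1 hv.2 hefx₁ hx₁4
          omega
        -- the two remaining points `p, q`
        have hrest : (((((gr N).erase b).erase b').erase f).erase e \ {c, u, v}).card = 2 := by
          rw [card_sdiff_of_subset (by
            intro a ha; simp only [mem_insert, mem_singleton] at ha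
            rcases ha with rfl | rfl | rfl <;> assumption), hX5]
          rw [card_insert_of_notMem, card_pair huv]
          simp only [mem_insert, mem_singleton, not_or]; exact ⟨huc.symm, hvc.symm⟩
        obtain ⟨p, q, hpq, hrest_eq⟩ := card_eq_two.1 hrest
        have hpR : p ∈ ((((gr N).erase b).erase b').erase f).erase e \ {c, u, v} := by
          rw [hrest_eq]; exact mem_insert_self _ _
        have hqR : q ∈ ((((gr N).erase b).erase b').erase f).erase e \ {c, u, v} := by
          rw [hrest_eq]; exact mem_insert_of_mem (mem_singleton_self _)
        have hpX := (mem_sdiff.1 hpR).1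
        have hqX := (mem_sdiff.1 hqR).1
        have hp3 := (mem_sdiff.1 hpR).2
        have hq3 := (mem_sdiff.1 hqR).2
        simp only [mem_insert, mem_singleton, not_or] at hp3 hq3
        have hXeq : ((((gr N).erase b).erase b').erase f).erase e = {c, u, v, p, q} := by
          ext a
          constructor
          · intro ha
            by_cases ha3 : a ∈ ({c, u, v} : Finset α)
            · simp only [mem_insert, mem_singleton] at ha3
              rcases ha3 with rfl | rfl | rfl
              · exact mem_insert_self _ _
              · exact mem_insert_of_mem (mem_insert_self _ _)
              · exact mem_insert_of_mem (mem_insert_of_mem (mem_insert_self _ _))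
            · have : a ∈ ((((gr N).erase b).erase b').erase f).erase e \ {c, u, v} := mem_sdiff.2 ⟨ha, ha3⟩
              rw [hrest_eq] at this
              simp only [mem_insert, mem_singleton] at this
              rcases this with rfl | rfl
              · exact mem_insert_of_mem (mem_insert_of_mem (mem_insert_of_mem (mem_insert_self _ _)))
              · exact mem_insert_of_mem (mem_insert_of_mem (mem_insert_of_mem (mem_insert_of_mem
                  (mem_singleton_self _))))
          · intro ha
            simp only [mem_insert, mem_singleton] at ha
            rcases ha with rfl | rfl | rfl | rfl | rfl <;> assumption
        -- the facts in the explicit form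
        rw [hπ₁eq] at hY₁ hYc₁ hres₁
        rw [hπ₂eq] at hY₂ hYc₂ hres₂
        have hcu : c ≠ u := huc.symm
        have hcv : c ≠ v := hvc.symm
        have hsd1 : ((((gr N).erase b).erase b').erase f).erase e \ {c, u} = {v, p, q} := by
          rw [hXeq]
          exact quint_sdiff_xy hcv (Ne.symm hp3.1) (Ne.symm hq3.1) huv (Ne.symm hp3.2.1) (Ne.symm hq3.2.1)
        have hsd2 : ((((gr N).erase b).erase b').erase f).erase e \ {c, v} = {u, p, q} := by
          rw [hXeq, quint_swap23]
          exact quint_sdiff_xy hcu (Ne.symm hp3.1) (Ne.symm hq3.1) huv.symm (Ne.symm hp3.2.2) (Ne.symm hq3.2.2)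
        rw [hsd1] at hYc₁ hres₁
        rw [hsd2] at hYc₂ hres₂
        have hu' : ¬ (rk N {e, f, u} = 3 ∧ rk N {c, v, p, q} = 4) := by
          rw [← quint_erase_second hcu huv (Ne.symm hp3.2.1) (Ne.symm hq3.2.1), ← hXeq]; exact hu
        have hv' : ¬ (rk N {e, f, v} = 3 ∧ rk N {c, u, p, q} = 4) := by
          rw [← quint_erase_z hcv huv (Ne.symm hp3.2.2) (Ne.symm hq3.2.2), ← hXeq]; exact hv
        obtain ⟨⟨hefp, hXp⟩, hefq, hXq⟩ := cpoints_of_shared_endpoint he hf hef heb heb' he1 hf1 hfc hef2 hcu hcv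
          (Ne.symm hp3.1) (Ne.symm hq3.1) huv (Ne.symm hp3.2.1) (Ne.symm hq3.2.1) (Ne.symm hp3.2.2)
          (Ne.symm hq3.2.2) hpq huX hvX hpX hqX hXeq hY₁ hYc₁ hres₁ hY₂ hYc₂ hres₂ hu' hv'
        have hp4 : rk N ((((((gr N).erase b).erase b').erase f).erase e).erase p) = 4 := by
          rw [hXeq, quint_erase_fourth (Ne.symm hp3.1) (Ne.symm hp3.2.1) (Ne.symm hp3.2.2) hpq]; exact hXp
        have hq4 : rk N ((((((gr N).erase b).erase b').erase f).erase e).erase q) = 4 := by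
          rw [hXeq, quint_erase_fifth (Ne.symm hq3.1) (Ne.symm hq3.2.1) (Ne.symm hq3.2.2) hpq]; exact hXq
        have h' := two_le_card_targets_of_loop h hn hbb he hf hef heb heb' hfb hfb' hpq hpX hqX hefp hp4 hefq hq4
        omega
      · have h' := two_le_card_targets_of_loop h hn hbb he hf hef heb heb' hfb hfb' hx12 (hπX₁ hx₁π) (hπX₂ hx₂π)
          hefx₁ hx₁4 hefx₂ hx₂4
        omega

/-- **THE LOOP REGIME WITH AT MOST TWO DEFECTS**: `ρ{b, b′} = 1` (every set ON), at most two demands without a swap;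
then the `b′`-avoiding inequality holds. -/
theorem inCount_thru_le_of_loop_of_le_two_bad (hn : (gr N).card = 9) (h : SeriesPair N b b')
    {e f : α} (he : e ∈ gr N) (hf : f ∈ gr N) (hef : e ≠ f) (heb : e ≠ b) (heb' : e ≠ b') (hfb : f ≠ b) (hfb' : f ≠ b')
    (he1 : ∀ y ∈ ((((gr N).erase b).erase b').erase f).erase e, rk N {e, y} = 2)
    (hf1 : ∀ y ∈ ((((gr N).erase b).erase b').erase f).erase e, rk N {f, y} = 2)
    (hfc : ∀ y ∈ ((((gr N).erase b).erase b').erase f).erase e, rk N (((((gr N).erase b).erase b').erase f).erase y) = 4)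
    (hX : rk N (((((gr N).erase b).erase b').erase f).erase e) = 4) (hef2 : rk N {e, f} = 2)
    (hbb : rk N {b, b'} = 1)
    (htwo : ∀ W₁ ∈ d0DON N b' e f, ∀ W₂ ∈ d0DON N b' e f, ∀ W₃ ∈ d0DON N b' e f,
      ¬ d0c0 N b b' e f W₁ → ¬ d0c0 N b b' e f W₂ → ¬ d0c0 N b b' e f W₃ → W₁ = W₂ ∨ W₁ = W₃ ∨ W₂ = W₃) :
    inCount N 4 e + thruCount N 4 {b', f} + thruCount N 4 {b', e, f} ≤
      inCount N 4 f + thruCount N 4 {e, f} + thruCount N 4 {b', e} := by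
  apply inCount_thru_le_of_loop_of_bad_bound hn h he hf hef heb heb' hfb hfb'
  apply card_bad_le_targets_of_card_le_two hn h he hf hef heb heb' hfb hfb' he1 hf1 hfc hX hef2 hbb
  apply card_le_two_of_no_three
  intro x hx y hy z hz
  simp only [mem_filter] at hx hy hz
  exact htwo x hx.1 y hy.1 z hz.1 hx.2 hy.2 hz.2

end StarSharpLoopC

end PercRepro.Cogirth
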